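import Mathlib
import HarnessLib
import Summits.Ventures.LatticeQCDFlow.Scaling.IdentityFlowCouplingWindow
import Summits.Ventures.LatticeQCDFlow.Scaling.LossCouplingInversion
import Summits.Ventures.LatticeQCDFlow.Scaling.TiltKLDivergence
import Summits.Ventures.LatticeQCDFlow.Scaling.BregmanDiagonalLimit
import Summits.Ventures.LatticeQCDFlow.Scaling.TiltTransferDiagonalLimit

/-!
# LatticeQCDFlow / Scaling — THE ACCEPTANCE ALONG EVERY COUPLING SEQUENCE, AND THE KULLBACK–LEIBLER
# LOSS DETERMINES THE ACCEPTANCE: `KL_n(β_n) → D` ⇒ `acc_n(β_n) → erfc(√(D/2))` (also for transfer)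

HONEST FRAMING: exact (Metropolis-corrected) sampling algorithms for lattice gauge theory;
figures of merit are autocorrelation/cost numbers at stated couplings and volumes; no
continuum-physics claim.

Venture `LatticeQCDFlow` (cell pub-lqcd), topic `Scaling`; FANOUT row 3 (`s0-u1-a`, S0-B
implementation A, GEN-20).  NEW WORK of the cell — assembly of row 3's
`Scaling/IdentityFlowCouplingWindow` (acceptance antitone in `β ≥ 0`, `0 ≤ acc ≤ 1`, the window ends
`β_n√n → 0 / ∞`), `Scaling/IdentityFlowAcceptanceDiagonalLimit` (the diagonal profile
`erfc(|c|σ/2)`), `Scaling/LossCouplingInversion` (`n·cgf(β_n) → D ⇒ β_n√n → √(2D/σ²)`),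
`Scaling/TiltKLDivergence` (the `n`-block reverse loss IS `n·(cgf(β) − β·E g)` as a Mathlib `klDiv`),
`Scaling/BregmanDiagonalLimit` (recentring of `cgf`) and `Scaling/TiltTransferDiagonalLimit` (shift
invariance of the acceptance functional); NO definition is introduced; nothing is cited.

## Setting and content (all `[ours]`)

`n` i.i.d. blocks of law `ν`, a bounded measurable CENTRED non-degenerate block statistic `g`
(`|g| ≤ K`, `∫ g dν = 0`, `σ² = Var g ≠ 0`), the untrained exact sampler (proposal `ν^{⊗n}`, target
`e^{βT}ν^{⊗n}/M(β)^n`, `T = Σᵢ g(xᵢ)`), its equilibrium acceptance `acc_n(β)` and its reverse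
training loss `KL_n(β) = n·cgf_g(β)` (`Scaling/TiltKLDivergence`, `toReal_klDiv_pi_tilted_right`
with `E g = 0`).
* §1 **`tiltPi_meanAccept_tendsto_of_sqrt_mul_tendsto`** — for EVERY coupling sequence with
  `β_n√n → c > 0`: `acc_n(β_n) → erfc(cσ/2)` (row 3's GEN-19 diagonal theorem had `β_n = c/√n`
  exactly; squeeze between the diagonals `(c ± ε)/√n` by monotonicity, then continuity of the
  profile, `Scaling/LossCouplingInversion` §0); with `Scaling/IdentityFlowCouplingWindow` (`c = 0`: `→ 1`; `c = ∞`: `→ 0`) the large-volume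
  acceptance of the untrained sampler is a function of `lim β_n√n` alone.
* §3 (any mean, `klDiv` vocabulary): `abs_integral_le_of_abs_le`, `abs_sub_integral_le_two_mul`,
  **`tiltPi_meanAccept_tendsto_of_sqrt_mul_tendsto_of_bounded`**, **`tiltPi_meanAccept_tendsto_of_klDiv_tendsto`**
  — THE HEADLINE in Mathlib vocabulary: `KL(ν^{⊗n} ‖ (ν^{⊗n}).tilted(β_n T)) → D ⇒ acc_n(β_n) → erfc(√(D/2))`;
  **`tiltedPi_transfer_tendsto_of_sqrt_mul_tendsto`**, **`tiltedPi_transfer_tendsto_of_klDiv_tendsto`** —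
  COUPLING TRANSFER of a factorised flow perfectly trained at `β₀` (proposal `ν_{β₀}^{⊗n}`): offsets
  `δ_n√n → c > 0 ⇒ acc → erfc(cσ(β₀)/2)`; transfer loss `→ D ⇒ acc → erfc(√(D/2))`.
* §2 **`tiltPi_meanAccept_tendsto_of_loss_tendsto`** — THE LOSS DETERMINES THE ACCEPTANCE: if the
  total reverse training loss `n·cgf_g(β_n)` converges to `D` (necessarily `D ≥ 0`) along
  non-negative couplings, then `acc_n(β_n) → (2/√π)∫_{√(D/2)}^∞ e^{−u²} du = erfc(√(D/2))`
  (`D = 0` included: `→ 1`).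

Reading (value-free): in the large-volume regime the equilibrium acceptance of the untrained exact
sampler is a universal decreasing function `erfc(√(D/2))` of its limiting training loss `D` (nats
per configuration), whatever the coupling sequence.
Reading, continued: for exact samplers of the tilt family — untrained, or trained at one coupling
and reused at another — the large-volume equilibrium acceptance is the universal function
`erfc(√(D/2))` of the limiting Kullback–Leibler loss `D` alone.
NOT CLAIMED: negative couplings / offsets (symmetric under `g ↦ −g`); rates; flows outside the tilt
family; any value at the cell's `(β, L)`; nothing re-scored.
-/

noncomputable section

namespace Summit.Ventures.LatticeQCDFlow.Theory2

open MeasureTheory ProbabilityTheory InformationTheory Filter Finset Real Set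
open scoped Topology NNReal ENNReal

/-! ## §1 The acceptance along every coupling sequence `β_n√n → c > 0` -/

section Sequences

variable {X : Type*} {mX : MeasurableSpace X} {ν : Measure X} [IsProbabilityMeasure ν] {g : X → ℝ}

/-- **THE ACCEPTANCE ALONG EVERY COUPLING SEQUENCE.**  Bounded centred non-degenerate block
statistic, couplings `β_n` with `β_n·√n → c > 0`: the equilibrium acceptance of the untrained
`n`-block sampler at `β_n` converges to `(2/√π)∫_{√(c²σ²)/2}^∞ e^{−u²} du = erfc(cσ/2)` — the same
limit as on the exact diagonal `β_n = c/√n` (`tiltPi_meanAccept_diag_tendsto_erfc`).  [ours] -/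
theorem tiltPi_meanAccept_tendsto_of_sqrt_mul_tendsto (hgm : Measurable g) {K : ℝ}
    (hK : ∀ x, |g x| ≤ K) (h0 : ∫ x, g x ∂ν = 0) (hσ : Var[g; ν] ≠ 0) {β : ℕ → ℝ} {c : ℝ}
    (hc : 0 < c) (hβ : Tendsto (fun n : ℕ => β n * Real.sqrt n) atTop (𝓝 c)) :
    Tendsto (fun n : ℕ =>
        (∫ x, ∫ y, min (Real.exp (β n * ∑ i, g (x i))) (Real.exp (β n * ∑ i, g (y i)))
            ∂(Measure.pi fun _ : Fin n => ν) ∂(Measure.pi fun _ : Fin n => ν))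
          / ∫ x, Real.exp (β n * ∑ i, g (x i)) ∂(Measure.pi fun _ : Fin n => ν))
      atTop (𝓝 (2 / Real.sqrt Real.pi
        * ∫ u in Ioi (Real.sqrt (c ^ 2 * Var[g; ν]) / 2), Real.exp (-u ^ 2))) := by
  set P : ℝ → ℝ := fun c' => 2 / Real.sqrt Real.pi
      * ∫ u in Ioi (Real.sqrt (c' ^ 2 * Var[g; ν]) / 2), Real.exp (-u ^ 2) with hP
  have hPc : ContinuousAt P c := (continuous_erfcProfile (Var[g; ν])).continuousAt
  -- the couplings are eventually non-negative
  have hβpos : ∀ᶠ n : ℕ in atTop, 0 ≤ β n := by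
    filter_upwards [(tendsto_order.1 hβ).1 (c / 2) (by linarith), eventually_gt_atTop 0]
      with n hn hn0
    have hsn : 0 < Real.sqrt n := Real.sqrt_pos.2 (Nat.cast_pos.2 hn0)
    by_contra hneg
    push Not at hneg
    have : β n * Real.sqrt n ≤ 0 := mul_nonpos_of_nonpos_of_nonneg hneg.le hsn.le
    linarith
  rw [tendsto_order]
  refine ⟨fun a ha => ?_, fun b hb => ?_⟩
  · -- lower bound: squeeze against the diagonal `(c + δ/2)/√n`
    obtain ⟨δ, hδ, hball⟩ := Metric.eventually_nhds_iff.1 ((tendsto_order.1 hPc.tendsto).1 a ha)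
    set c' : ℝ := c + δ / 2 with hc'
    have hc'0 : 0 < c' := by rw [hc']; linarith
    have hPc' : a < P c' := hball (by rw [Real.dist_eq, hc', add_sub_cancel_left, abs_of_pos (by linarith)]; linarith)
    have hdiag := tiltPi_meanAccept_diag_tendsto_erfc (ν := ν) hgm hK h0 hc'0.ne' hσ
    have hev1 := (tendsto_order.1 hdiag).1 a hPc'
    have hev2 : ∀ᶠ n : ℕ in atTop, β n ≤ c' / Real.sqrt n := by
      filter_upwards [(tendsto_order.1 hβ).2 c' (by rw [hc']; linarith), eventually_gt_atTop 0]
        with n hn hn0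
      have hsn : 0 < Real.sqrt n := Real.sqrt_pos.2 (Nat.cast_pos.2 hn0)
      rw [le_div_iff₀ hsn]
      exact hn.le
    filter_upwards [hev1, hev2, hβpos] with n h1 h2 h3
    exact h1.trans_le (tiltPi_meanAccept_le_of_le hgm hK n h3 h2)
  · -- upper bound: squeeze against the diagonal `(c − η)/√n`, `η = min(δ, c)/2`
    obtain ⟨δ, hδ, hball⟩ := Metric.eventually_nhds_iff.1 ((tendsto_order.1 hPc.tendsto).2 b hb)
    set η : ℝ := min δ c / 2 with hη
    have hη0 : 0 < η := by rw [hη]; positivity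
    have hηδ : η < δ := by
      rw [hη]; have := min_le_left δ c; linarith
    have hηc : η < c := by
      rw [hη]; have := min_le_right δ c; linarith
    set c' : ℝ := c - η with hc'
    have hc'0 : 0 < c' := by rw [hc']; linarith
    have hPc' : P c' < b := hball (by
      rw [Real.dist_eq, hc', show c - η - c = -η by ring, abs_neg, abs_of_pos hη0]; exact hηδ)
    have hdiag := tiltPi_meanAccept_diag_tendsto_erfc (ν := ν) hgm hK h0 hc'0.ne' hσ
    have hev1 := (tendsto_order.1 hdiag).2 b hPc'
    have hev2 : ∀ᶠ n : ℕ in atTop, c' / Real.sqrt n ≤ β n := by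
      filter_upwards [(tendsto_order.1 hβ).1 c' (by rw [hc']; linarith), eventually_gt_atTop 0]
        with n hn hn0
      have hsn : 0 < Real.sqrt n := Real.sqrt_pos.2 (Nat.cast_pos.2 hn0)
      rw [div_le_iff₀ hsn]
      exact hn.le
    filter_upwards [hev1, hev2, eventually_gt_atTop 0] with n h1 h2 hn0
    have hcn : 0 ≤ c' / Real.sqrt n := div_nonneg hc'0.le (Real.sqrt_nonneg _)
    exact (tiltPi_meanAccept_le_of_le hgm hK n hcn h2).trans_lt h1

end Sequences

/-! ## §2 The loss determines the acceptance -/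

section Dictionary

variable {X : Type*} {mX : MeasurableSpace X} {ν : Measure X} [IsProbabilityMeasure ν] {g : X → ℝ}

/-- **THE LOSS DETERMINES THE ACCEPTANCE.**  Bounded centred non-degenerate block statistic,
non-negative couplings `β_n`; if the total reverse training loss of the untrained `n`-block sampler,
`KL(ν^{⊗n} ‖ e^{β_n T}ν^{⊗n}/M^n) = n·cgf_g(β_n)`, converges to `D`, then its equilibrium acceptance
converges to `(2/√π)∫_{√(D/2)}^∞ e^{−u²} du = erfc(√(D/2))` (`D = 0`: to `1`). [ours] -/
theorem tiltPi_meanAccept_tendsto_of_loss_tendsto (hgm : Measurable g) {K : ℝ} (hK : ∀ x, |g x| ≤ K)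
    (h0 : ∫ x, g x ∂ν = 0) (hσ : Var[g; ν] ≠ 0) {β : ℕ → ℝ} (hβ0 : ∀ n, 0 ≤ β n) {D : ℝ}
    (hD : Tendsto (fun n : ℕ => (n : ℝ) * cgf g ν (β n)) atTop (𝓝 D)) :
    Tendsto (fun n : ℕ =>
        (∫ x, ∫ y, min (Real.exp (β n * ∑ i, g (x i))) (Real.exp (β n * ∑ i, g (y i)))
            ∂(Measure.pi fun _ : Fin n => ν) ∂(Measure.pi fun _ : Fin n => ν))
          / ∫ x, Real.exp (β n * ∑ i, g (x i)) ∂(Measure.pi fun _ : Fin n => ν))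
      atTop (𝓝 (2 / Real.sqrt Real.pi
        * ∫ u in Ioi (Real.sqrt (D / 2)), Real.exp (-u ^ 2))) := by
  have hv : 0 < Var[g; ν] := lt_of_le_of_ne (variance_nonneg _ _) (Ne.symm hσ)
  -- `D ≥ 0`
  have hD0 : 0 ≤ D :=
    ge_of_tendsto' hD fun n => mul_nonneg (Nat.cast_nonneg n) (cgf_nonneg_of_centred hgm hK h0 _)
  have hc := sqrt_mul_tendsto_of_nat_mul_cgf_tendsto hgm hK h0 hσ hβ0 hD
  rcases hD0.eq_or_lt with hz | hDpos
  · -- `D = 0`: below the window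
    subst hz
    simp only [mul_zero, zero_div, Real.sqrt_zero] at hc ⊢
    rw [erfcProfile_zero]
    exact tiltPi_meanAccept_tendsto_one hgm hK h0 hσ hβ0 hc
  · have hcpos : 0 < Real.sqrt (2 * D / Var[g; ν]) := Real.sqrt_pos.2 (by positivity)
    have h := tiltPi_meanAccept_tendsto_of_sqrt_mul_tendsto hgm hK h0 hσ hcpos hc
    have e : Real.sqrt (Real.sqrt (2 * D / Var[g; ν]) ^ 2 * Var[g; ν]) / 2 = Real.sqrt (D / 2) := by
      rw [Real.sq_sqrt (by positivity), div_mul_cancel₀ _ hv.ne',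
        show D / 2 = 2 * D / 2 ^ 2 by ring, Real.sqrt_div (by positivity) (2 ^ 2),
        Real.sqrt_sq zero_le_two]
    rw [e] at h
    exact h

end Dictionary

/-! ## §3 Any mean, `klDiv` vocabulary, and coupling transfer -/

section Bounded

variable {X : Type*} {mX : MeasurableSpace X} {ν : Measure X} [IsProbabilityMeasure ν] {g : X → ℝ}

/-- `|E g| ≤ K` for `|g| ≤ K`. [folklore] -/
theorem abs_integral_le_of_abs_le {K : ℝ} (hK : ∀ x, |g x| ≤ K) :
    |∫ x, g x ∂ν| ≤ K := by
  have h := norm_integral_le_of_norm_le_const (μ := ν) (f := g) (C := K)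
    (ae_of_all _ fun x => by rw [Real.norm_eq_abs]; exact hK x)
  simpa [Real.norm_eq_abs] using h

/-- The recentred statistic is bounded by `2K`. [folklore] -/
theorem abs_sub_integral_le_two_mul {K : ℝ} (hK : ∀ x, |g x| ≤ K) (x : X) :
    |g x - ∫ y, g y ∂ν| ≤ 2 * K := by
  have h1 := hK x
  have h2 := abs_integral_le_of_abs_le (ν := ν) hK
  calc |g x - ∫ y, g y ∂ν| ≤ |g x| + |∫ y, g y ∂ν| := abs_sub _ _
    _ ≤ K + K := add_le_add h1 h2
    _ = 2 * K := by ring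

/-- **The acceptance along every coupling sequence, non-centred statistic**: bounded `g` with
`Var g ≠ 0`, `β_n√n → c > 0` ⇒ `acc_n(β_n) → (2/√π)∫_{√(c²σ²)/2}^∞ e^{−u²}du` (shift invariance +
the centred theorem). [ours] -/
theorem tiltPi_meanAccept_tendsto_of_sqrt_mul_tendsto_of_bounded (hgm : Measurable g) {K : ℝ}
    (hK : ∀ x, |g x| ≤ K) (hσ : Var[g; ν] ≠ 0) {β : ℕ → ℝ} {c : ℝ} (hc : 0 < c)
    (hβ : Tendsto (fun n : ℕ => β n * Real.sqrt n) atTop (𝓝 c)) :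
    Tendsto (fun n : ℕ =>
        (∫ x, ∫ y, min (Real.exp (β n * ∑ i, g (x i))) (Real.exp (β n * ∑ i, g (y i)))
            ∂(Measure.pi fun _ : Fin n => ν) ∂(Measure.pi fun _ : Fin n => ν))
          / ∫ x, Real.exp (β n * ∑ i, g (x i)) ∂(Measure.pi fun _ : Fin n => ν))
      atTop (𝓝 (2 / Real.sqrt Real.pi
        * ∫ u in Ioi (Real.sqrt (c ^ 2 * Var[g; ν]) / 2), Real.exp (-u ^ 2))) := by
  set m : ℝ := ∫ x, g x ∂ν with hm
  have hgb : ∀ᵐ x ∂ν, g x ∈ Set.Icc (-K) K := ae_of_all _ fun x => abs_le.1 (hK x)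
  have hgi : Integrable g ν := Integrable.of_mem_Icc (-K) K hgm.aemeasurable hgb
  have hgm' : Measurable fun x => g x - m := hgm.sub_const m
  have hK' : ∀ x, |g x - m| ≤ 2 * K := abs_sub_integral_le_two_mul hK
  have h0' : ∫ x, (g x - m) ∂ν = 0 := by
    rw [integral_sub hgi (integrable_const _), integral_const, probReal_univ, one_smul, hm, sub_self]
  have hσ' : Var[fun x => g x - m; ν] ≠ 0 := by
    rwa [variance_sub_const hgm.aestronglyMeasurable]
  have h := tiltPi_meanAccept_tendsto_of_sqrt_mul_tendsto hgm' hK' h0' hσ' hc hβ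
  rw [variance_sub_const hgm.aestronglyMeasurable] at h
  exact h.congr fun n => tiltPi_meanAccept_sub_const m (β n) n

/-- **THE KULLBACK–LEIBLER LOSS DETERMINES THE ACCEPTANCE** (Mathlib vocabulary).  Bounded
measurable block statistic with `Var g ≠ 0`, couplings `β_n ≥ 0`; if the reverse training loss of the
untrained `n`-block sampler `KL(ν^{⊗n} ‖ (ν^{⊗n}).tilted(β_n·Σᵢ g(xᵢ)))` converges to `D`, then its
equilibrium acceptance converges to `(2/√π)∫_{√(D/2)}^∞ e^{−u²} du = erfc(√(D/2))`. [ours] -/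
theorem tiltPi_meanAccept_tendsto_of_klDiv_tendsto (hgm : Measurable g) {K : ℝ}
    (hK : ∀ x, |g x| ≤ K) (hσ : Var[g; ν] ≠ 0) {β : ℕ → ℝ} (hβ0 : ∀ n, 0 ≤ β n) {D : ℝ}
    (hD : Tendsto (fun n : ℕ => (klDiv (Measure.pi fun _ : Fin n => ν)
        ((Measure.pi fun _ : Fin n => ν).tilted fun y => β n * ∑ i, g (y i))).toReal) atTop (𝓝 D)) :
    Tendsto (fun n : ℕ =>
        (∫ x, ∫ y, min (Real.exp (β n * ∑ i, g (x i))) (Real.exp (β n * ∑ i, g (y i)))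
            ∂(Measure.pi fun _ : Fin n => ν) ∂(Measure.pi fun _ : Fin n => ν))
          / ∫ x, Real.exp (β n * ∑ i, g (x i)) ∂(Measure.pi fun _ : Fin n => ν))
      atTop (𝓝 (2 / Real.sqrt Real.pi
        * ∫ u in Ioi (Real.sqrt (D / 2)), Real.exp (-u ^ 2))) := by
  set m : ℝ := ∫ x, g x ∂ν with hm
  have hgb : ∀ᵐ x ∂ν, g x ∈ Set.Icc (-K) K := ae_of_all _ fun x => abs_le.1 (hK x)
  have hgi : Integrable g ν := Integrable.of_mem_Icc (-K) K hgm.aemeasurable hgb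
  have hgm' : Measurable fun x => g x - m := hgm.sub_const m
  have hK' : ∀ x, |g x - m| ≤ 2 * K := abs_sub_integral_le_two_mul hK
  have h0' : ∫ x, (g x - m) ∂ν = 0 := by
    rw [integral_sub hgi (integrable_const _), integral_const, probReal_univ, one_smul, hm, sub_self]
  have hσ' : Var[fun x => g x - m; ν] ≠ 0 := by
    rwa [variance_sub_const hgm.aestronglyMeasurable]
  -- the loss in `cgf` form: `KL_n(β) = n·(cgf(β) − β·m) = n·cgf_{g − m}(β)`
  have hD' : Tendsto (fun n : ℕ => (n : ℝ) * cgf (fun x => g x - m) ν (β n)) atTop (𝓝 D) := by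
    refine hD.congr fun n => ?_
    rw [toReal_klDiv_pi_tilted_right hgm hK,
      cgf_sub_const m (integrable_exp_mul_of_mem_Icc hgm.aemeasurable hgb)]
  have h := tiltPi_meanAccept_tendsto_of_loss_tendsto hgm' hK' h0' hσ' hβ0 hD'
  exact h.congr fun n => tiltPi_meanAccept_sub_const m (β n) n

end Bounded

/-! ## Coupling transfer of a perfectly trained factorised flow -/

section Transfer

variable {X : Type*} {mX : MeasurableSpace X} {ν : Measure X} [IsProbabilityMeasure ν] {g : X → ℝ}

/-- **TRANSFER ALONG EVERY OFFSET SEQUENCE**: a factorised flow perfectly trained at `β₀` (proposal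
`ν_{β₀}^{⊗n}`, `ν_{β₀} = ν.tilted(β₀ g)`) reused at `β₀ + δ_n`, `δ_n√n → c > 0`: acceptance
`→ (2/√π)∫_{√(c²σ(β₀)²)/2}^∞ e^{−u²}du = erfc(cσ(β₀)/2)`, `σ(β₀)² = Var_{ν_{β₀}} g ≠ 0`. [ours] -/
theorem tiltedPi_transfer_tendsto_of_sqrt_mul_tendsto (hgm : Measurable g) {K : ℝ}
    (hK : ∀ x, |g x| ≤ K) (β₀ : ℝ) (hσ : Var[g; ν.tilted fun x => β₀ * g x] ≠ 0) {δ : ℕ → ℝ}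
    {c : ℝ} (hc : 0 < c) (hδ : Tendsto (fun n : ℕ => δ n * Real.sqrt n) atTop (𝓝 c)) :
    Tendsto (fun n : ℕ =>
        (∫ x, ∫ y, min (Real.exp (δ n * ∑ i, g (x i))) (Real.exp (δ n * ∑ i, g (y i)))
            ∂(Measure.pi fun _ : Fin n => ν.tilted fun x => β₀ * g x)
            ∂(Measure.pi fun _ : Fin n => ν.tilted fun x => β₀ * g x))
          / ∫ x, Real.exp (δ n * ∑ i, g (x i)) ∂(Measure.pi fun _ : Fin n => ν.tilted fun x => β₀ * g x))
      atTop (𝓝 (2 / Real.sqrt Real.pi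
        * ∫ u in Ioi (Real.sqrt (c ^ 2 * Var[g; ν.tilted fun x => β₀ * g x]) / 2),
            Real.exp (-u ^ 2))) := by
  have hgb : ∀ᵐ x ∂ν, g x ∈ Set.Icc (-K) K := ae_of_all _ fun x => abs_le.1 (hK x)
  haveI : IsProbabilityMeasure (ν.tilted fun x => β₀ * g x) :=
    isProbabilityMeasure_tilted (integrable_exp_mul_of_mem_Icc hgm.aemeasurable hgb)
  exact tiltPi_meanAccept_tendsto_of_sqrt_mul_tendsto_of_bounded hgm hK hσ hc hδ

/-- **THE TRANSFER LOSS DETERMINES THE TRANSFER ACCEPTANCE**: offsets `δ_n ≥ 0`; if the reverse loss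
`KL(ν_{β₀}^{⊗n} ‖ (ν_{β₀}^{⊗n}).tilted(δ_n·Σᵢ g(xᵢ)))` of the flow trained at `β₀` against the
target at `β₀ + δ_n` converges to `D`, the acceptance converges to `erfc(√(D/2))`. [ours] -/
theorem tiltedPi_transfer_tendsto_of_klDiv_tendsto (hgm : Measurable g) {K : ℝ}
    (hK : ∀ x, |g x| ≤ K) (β₀ : ℝ) (hσ : Var[g; ν.tilted fun x => β₀ * g x] ≠ 0) {δ : ℕ → ℝ}
    (hδ0 : ∀ n, 0 ≤ δ n) {D : ℝ}
    (hD : Tendsto (fun n : ℕ => (klDiv (Measure.pi fun _ : Fin n => ν.tilted fun x => β₀ * g x)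
        ((Measure.pi fun _ : Fin n => ν.tilted fun x => β₀ * g x).tilted
          fun y => δ n * ∑ i, g (y i))).toReal) atTop (𝓝 D)) :
    Tendsto (fun n : ℕ =>
        (∫ x, ∫ y, min (Real.exp (δ n * ∑ i, g (x i))) (Real.exp (δ n * ∑ i, g (y i)))
            ∂(Measure.pi fun _ : Fin n => ν.tilted fun x => β₀ * g x)
            ∂(Measure.pi fun _ : Fin n => ν.tilted fun x => β₀ * g x))
          / ∫ x, Real.exp (δ n * ∑ i, g (x i)) ∂(Measure.pi fun _ : Fin n => ν.tilted fun x => β₀ * g x))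
      atTop (𝓝 (2 / Real.sqrt Real.pi * ∫ u in Ioi (Real.sqrt (D / 2)), Real.exp (-u ^ 2))) := by
  have hgb : ∀ᵐ x ∂ν, g x ∈ Set.Icc (-K) K := ae_of_all _ fun x => abs_le.1 (hK x)
  haveI : IsProbabilityMeasure (ν.tilted fun x => β₀ * g x) :=
    isProbabilityMeasure_tilted (integrable_exp_mul_of_mem_Icc hgm.aemeasurable hgb)
  exact tiltPi_meanAccept_tendsto_of_klDiv_tendsto hgm hK hσ hδ0 hD

end Transfer

end Summit.Ventures.LatticeQCDFlow.Theory2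

end
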